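import Literature.Computability.Complexity.ExpPadding
import Literature.Computability.Complexity.TruncMapMachine
import Literature.Computability.Complexity.PlumbingBricks
import Literature.Computability.Complexity.PPolyReductions
import HarnessLib

/-!
# Padding for the tree's `NTIME`: `NTIME(2ⁿ) ⊆ P/poly → NEXP ⊆ P/poly`

Literature / complexity toolkit (serves the decomposition of Williams' transfer theorem,
`Williams2014Transfer.lean`, named fact `NEXP_subset_PPoly_of_NTIME_two_pow_subset`). The
translation "`NTIME[2ⁿ] ⊆ 𝒞 ⟹ NEXP ⊆ 𝒞`" by polynomial padding (Arora–Barak 2009, §2.6.2,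
proof of Thm. 2.22; Williams 2014, proof of Thm. 1.1, p. 17) is, in the tree's one-constant
verifier form of `NTIME` (`Nondeterministic.lean`), a genuine machine construction: a verifier
for `L ∈ NTIME(2^{nᵏ})` with constant `c` is specified only on witnesses of length
`≤ c · 2^{nᵏ} + c`, so the verifier of the padded language must (i) recover the payload, (ii) cut
the witness at EXACTLY that length, reading the rest two symbols per step, and (iii) only then
run the given verifier. Step (ii) is the truncating wrapper `truncMapAux` of
`TruncMapMachine.lean`, fed by an exponential-time CLOCK machine:

* `expClock c k x = ⟨x, 1^{c · 2^{|x|^k} + c}⟩` and its machine (`ExpPad.clockProg`, a variant of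
  the structured stack program `ExpPad.prog` of `ExpPadding.lean`: same registers and stages,
  new output stage `ExpPad.finishClock`), **`exists_timeComputable_expClock`**: time
  `C · 2^{nᵏ} + C` for `1 ≤ k`;
* the polynomial padding `polyPad k x = ⟨x, 1^{|x|^k}⟩`, its total inverse `polyUnpad k`
  (`⟨x, 1^{|x|^k}⟩ ↦ x`, every other word `↦ ε`; both in `FP`, assembled from bricks), and the
  padded language `padPre k L = polyUnpad k ⁻¹' L` with `L ≤ₚ padPre k L`
  (`karpReducible_padPre`);
* **`padPre_mem_NTIME_two_pow`**: `L ∈ NTIME(2^{nᵏ}) → padPre k L ∈ NTIME(2ⁿ)` — the verifier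
  `truncMapAux (unpad, then clock) ∘ (verifier of L)`;
* **`NEXP_subset_PPoly_of_NTIME_two_pow_subset_PPoly`**:
  `NTIME (2 ^ ·) ⊆ PPoly → NEXP ⊆ PPoly` (closure of `P/poly` under Karp reductions,
  `mem_PPoly_of_karpReducible`).

## Design notes

* Invalid words (not of the form `⟨x, 1^{|x|^k}⟩`) are sent to `ε` by `polyUnpad`, i.e. treated
  as pads of the empty word, so that no validity flag has to be threaded through the pair code:
  the running time stays `O(2^N)` because `|polyUnpad k z|^k ≤ |z|` or `polyUnpad k z = ε`.
* The clock length is exactly the admissible witness length `c · 2^{nᵏ} + c` of the given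
  verifier: shorter would lose witnesses, longer would leave the verifier unspecified.
* `k = 0` (the member `NTIME(2)` of the union `NEXP`) needs no exponential clock (the clock word
  is `⟨x, 1^{3c}⟩`, polynomial-time); both cases are fed to one machine lemma through a
  "polynomial + `C · 2^{nᵏ}`" time bound (`exists_clock_machine`).

## References

* S. Arora, B. Barak, *Computational Complexity: A Modern Approach*, CUP 2009, §2.6.2 and
  Thm. 2.22 (padding, "translating upward"), Def. 2.1 / §2.1.2, §1.3, §6.1.
* R. Williams, *Nonuniform ACC circuit lower bounds*, J. ACM 61 (2014), proof of Thm. 1.1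
  (p. 17: "if `NTIME[2ⁿ]` has polysize `ACC` circuits, then every language in `NEXP` has
  polysize `ACC` circuits").
* T. Nipkow, G. Klein, *Concrete Semantics with Isabelle/HOL*, Springer 2014, Ch. 7 (big-step
  cost semantics) — the verification style of `SymbolPrograms.lean`.
-/

namespace Literature.Computability.Complexity

open _root_.Computability
/-- **The exponential witness clock** `expClock c k x = ⟨x, 1^{c · 2^{|x|^k} + c}⟩` (pair code
`boolPair`): the admissible witness length of an `NTIME(2^{nᵏ})` verifier with constant `c`, in
unary, behind the payload `x`. [folklore] -/
def expClock (c k : ℕ) (x : List Bool) : List Bool :=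
  boolPair x (List.replicate (c * 2 ^ (x.length ^ k) + c) true)

/-- Length of the clock word: `2|x| + 2 + (c · 2^{|x|^k} + c)`. [folklore] -/
@[simp] theorem length_expClock (c k : ℕ) (x : List Bool) :
    (expClock c k x).length = 2 * x.length + 2 + (c * 2 ^ (x.length ^ k) + c) := by
  simp [expClock]

/-- The second component of the clock word is the unary clock. [folklore] -/
@[simp] theorem boolUnpair_expClock (c k : ℕ) (x : List Bool) :
    boolUnpair (expClock c k x) = (x, List.replicate (c * 2 ^ (x.length ^ k) + c) true) := by
  simp [expClock]

namespace ExpPad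

open ACom

/-! ### Output routines -/

/-- `pushOnes c`: push `c` tokens `1` on the output register. [folklore] -/
def pushOnes : ℕ → Prog
  | 0 => skip
  | c + 1 => push .out true ;; pushOnes c

/-- Effect and cost of `pushOnes c`: `out := 1ᶜ ++ out` in `c` steps. [folklore] -/
theorem runs_pushOnes (i xr u u2 p q e f o : List Bool) : ∀ c : ℕ,
    Runs (pushOnes c) (mk i xr u u2 p q e f o) (mk i xr u u2 p q e f (un c ++ o)) c
  | 0 => by simpa [pushOnes, un] using Runs.skip (mk i xr u u2 p q e f o)
  | c + 1 => by
    have h1 : Runs (push Rg.out true) (mk i xr u u2 p q e f o)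
        (mk i xr u u2 p q e f (true :: o)) 1 := Runs.push' (by simp)
    have h2 := runs_pushOnes i xr u u2 p q e f (true :: o) c
    refine (h1.seq h2).of_eq ?_ (by omega)
    simp [un, List.replicate_succ']

/-- Effect and cost of the clock-multiplication loop `loop e (pushOnes c)`: for `e = 1^E`,
`out := 1^{c E} ++ out`, `e := []`, in `(c + 2) E + 1` steps. [folklore] -/
theorem runs_mulOnes (i xr u u2 p q f o : List Bool) (c E : ℕ) :
    Runs (loop .e fun _ => pushOnes c) (mk i xr u u2 p q (un E) f o)
      (mk i xr u u2 p q [] f (un (c * E) ++ o)) ((c + 2) * E + 1) := by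
  have h := runs_loop_inv (k := Rg.e) (f := fun _ => pushOnes c)
    (fun done rest => mk i xr u u2 p q rest f (un (c * done.length) ++ o))
    (fun _ _ => True) c
    (fun _ _ _ => rfl)
    (fun done a rest _ => ⟨trivial, by
      rw [update_mk_e]
      refine (runs_pushOnes i xr u u2 p q rest f (un (c * done.length) ++ o) c).of_eq ?_ le_rfl
      simp only [List.length_cons, un, ← List.append_assoc, ← List.replicate_add]
      congr 2
      ring⟩)
    (un E) [] trivial
  simpa [un] using h

/-- Effect and cost of the doubling output loop `loop xr (push out b ;; push out b)`: for
`xr = x.reverse`, `out := (x with every bit doubled) ++ out`, `xr := []`, in `4 |x| + 1` steps.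
[folklore] -/
theorem runs_dblOut (i u u2 p q e f o x : List Bool) :
    Runs (loop .xr fun b => push .out b ;; push .out b) (mk i x.reverse u u2 p q e f o)
      (mk i [] u u2 p q e f ((x.flatMap fun b => [b, b]) ++ o)) (4 * x.length + 1) := by
  have h := runs_loop_inv (k := Rg.xr) (f := fun b => push .out b ;; push .out b)
    (fun done rest => mk i rest u u2 p q e f ((done.flatMap fun b => [b, b]) ++ o))
    (fun _ _ => True) 2
    (fun _ _ _ => rfl)
    (fun done a rest _ => ⟨trivial, by
      rw [update_mk_xr]
      refine ((Runs.push' rfl).seq (Runs.push' ?_)).of_eq rfl (by norm_num)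
      simp⟩)
    x.reverse [] trivial
  simpa using h

/-- `finishClock c`: write the clock `1^{c E + c}` (from `e = 1^E`), the separator `1, 0` and the
doubled payload (from `xr = x.reverse`) to the output, so that it reads
`boolPair x (1^{c E + c})`; clear `u`. [folklore] -/
def finishClock (c : ℕ) : Prog :=
  (loop .e fun _ => pushOnes c) ;; pushOnes c ;; push .out true ;; push .out false ;;
    (loop .xr fun b => push .out b ;; push .out b) ;; clear .u

/-- Effect and cost of `finishClock c`. [folklore] -/
theorem runs_finishClock (c : ℕ) (x : List Bool) (n E : ℕ) :
    Runs (finishClock c) (mk [] x.reverse (un n) [] [] [] (un E) [] [])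
      (mk [] [] [] [] [] [] [] [] (boolPair x (un (c * E + c))))
      (((c + 2) * E + 1) + c + 1 + 1 + (4 * x.length + 1) + (2 * n + 1)) := by
  unfold finishClock
  have h1 := runs_mulOnes [] x.reverse (un n) [] [] [] [] [] c E
  simp only [List.append_nil] at h1
  have h2 := runs_pushOnes [] x.reverse (un n) [] [] [] [] [] (un (c * E)) c
  have h12 : un c ++ un (c * E) = un (c * E + c) := by
    simp only [un, ← List.replicate_add]
    congr 1
    ring
  rw [h12] at h2
  have h3 : Runs (push Rg.out true) (mk [] x.reverse (un n) [] [] [] [] [] (un (c * E + c)))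
      (mk [] x.reverse (un n) [] [] [] [] [] (true :: un (c * E + c))) 1 := Runs.push' (by simp)
  have h4 : Runs (push Rg.out false) (mk [] x.reverse (un n) [] [] [] [] [] (true :: un (c * E + c)))
      (mk [] x.reverse (un n) [] [] [] [] [] (false :: true :: un (c * E + c))) 1 :=
    Runs.push' (by simp)
  have h5 := runs_dblOut [] (un n) [] [] [] [] [] (false :: true :: un (c * E + c)) x
  have h6 := runs_clear (Γ := Bool) Rg.u
    (mk [] [] (un n) [] [] [] [] [] ((x.flatMap fun b => [b, b]) ++ false :: true :: un (c * E + c)))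
  simp only [mk_u, update_mk_u, un, List.length_replicate] at h6
  have := h1.seq (h2.seq (h3.seq (h4.seq (h5.seq h6))))
  refine this.of_eq ?_ (by omega)
  simp [boolPair, un]

/-! ### The whole clock program -/

/-- **The clock program** for constant `c` and exponent `k`: the stages `split`, `powLoop k`
and the doubling loop of `ExpPad.prog k`, followed by `finishClock c`. [folklore] -/
def clockProg (c k : ℕ) : Prog :=
  split ;; push .p true ;; powLoop k ;; push .e true ;; (loop .p fun _ => dbl) ;; finishClock c

/-- Cost of the clock program on inputs of length `n`. [folklore] -/
def cClock (c k n : ℕ) : ℕ :=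
  (4 * n + 1) + 1 + cPow n k + 1 + cExp (n ^ k) 1 +
    (((c + 2) * 2 ^ (n ^ k) + 1) + c + 1 + 1 + (4 * n + 1) + (2 * n + 1))

/-- **Effect and cost of the clock program**: from the input store holding `x` to the output
store holding `expClock c k x`, within `cClock c k |x|` steps. [folklore] -/
theorem runs_clockProg (c k : ℕ) (x : List Bool) :
    Runs (clockProg c k) (AStore.single .inp x) (AStore.single .out (expClock c k x))
      (cClock c k x.length) := by
  rw [single_inp, single_out]
  unfold clockProg cClock
  have h1 := runs_split x
  have h2 : Runs (push Rg.p true) (mk [] x.reverse (un x.length) [] [] [] [] [] [])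
      (mk [] x.reverse (un x.length) [] (un 1) [] [] [] []) 1 := Runs.push' (by simp [un])
  have h3 := runs_powLoop [] x.reverse [] [] [] x.length k
  have h4 : Runs (push Rg.e true) (mk [] x.reverse (un x.length) [] (un (x.length ^ k)) [] [] [] [])
      (mk [] x.reverse (un x.length) [] (un (x.length ^ k)) [] (un 1) [] []) 1 :=
    Runs.push' (by simp [un])
  have h5 := runs_expLoop [] x.reverse (un x.length) [] [] [] (x.length ^ k) 1
  simp only [one_mul] at h5
  have h6 := runs_finishClock c x x.length (2 ^ (x.length ^ k))
  have := h1.seq (h2.seq (h3.seq (h4.seq (h5.seq h6))))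
  refine this.of_eq ?_ (by omega)
  simp [expClock, un]

/-! ### The time bound -/

/-- Closed form of the total cost:
`cClock c k n + 1 = cPow n k + (c + 12) · 2^{nᵏ} + 4 nᵏ + 10 n + c`. [folklore] -/
theorem cClock_add_one_eq (c k n : ℕ) :
    cClock c k n + 1 = cPow n k + (c + 12) * 2 ^ (n ^ k) + 4 * n ^ k + 10 * n + c := by
  have h := cExp_eq (n ^ k) 1
  have h1 : 1 ≤ 2 ^ (n ^ k) := Nat.one_le_two_pow
  have e1 : (c + 2) * 2 ^ (n ^ k) = c * 2 ^ (n ^ k) + 2 * 2 ^ (n ^ k) := by ring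
  have e2 : (c + 12) * 2 ^ (n ^ k) = c * 2 ^ (n ^ k) + 12 * 2 ^ (n ^ k) := by ring
  unfold cClock
  rw [e1, e2]
  omega

/-- **The clock program runs in time `O(2^{n^k})`** (`1 ≤ k`): `cClock c k n + 1 ≤ C · 2^{n^k} + C`
for a constant `C` depending on `c` and `k`. [folklore] -/
theorem exists_cClock_le (c k : ℕ) (hk : 1 ≤ k) :
    ∃ C : ℕ, ∀ n : ℕ, cClock c k n + 1 ≤ C * 2 ^ (n ^ k) + C := by
  open Polynomial in
  obtain ⟨c₀, hc₀⟩ := TimeConstructible.exists_poly_le_two_pow_pow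
    (cPowPoly k + Polynomial.C 4 * X ^ k + Polynomial.C 10 * X + Polynomial.C c) hk
  refine ⟨c₀ + (c + 12), fun n => ?_⟩
  have h := hc₀ n
  simp only [eval_add, eval_mul, eval_C, eval_pow, eval_X, eval_cPowPoly] at h
  have e3 : (c₀ + (c + 12)) * 2 ^ (n ^ k) = c₀ * 2 ^ (n ^ k) + (c + 12) * 2 ^ (n ^ k) := by ring
  rw [cClock_add_one_eq, e3]
  omega

end ExpPad

/-! ### The clock is computable in exponential time -/

open ExpPad in
/-- **The clock is computed by a multi-stack machine within `cClock c k |x| + 1` steps** (the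
structured program `ExpPad.clockProg c k` compiled by `ACom.exists_computesInTime`).
[folklore] -/
theorem exists_computesInTime_expClock (c k : ℕ) :
    ∃ M : Turing.TM2ComputableAux Bool Bool,
      ComputesInTime (id : List Bool → List Bool) id (expClock c k)
        (fun x => cClock c k x.length + 1) M :=
  ACom.exists_computesInTime (clockProg c k) .inp .out id id (expClock c k)
    (fun x => cClock c k x.length) (runs_clockProg c k)

/-- **`expClock c k` is computable in time `C · 2^{n^k} + C`** (`1 ≤ k`). [folklore] -/
theorem exists_timeComputable_expClock (c : ℕ) {k : ℕ} (hk : 1 ≤ k) :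
    ∃ C : ℕ, TimeComputable (id : List Bool → List Bool) id (expClock c k)
      (fun n => C * 2 ^ (n ^ k) + C) := by
  obtain ⟨C, hC⟩ := ExpPad.exists_cClock_le c k hk
  obtain ⟨M, hM⟩ := exists_computesInTime_expClock c k
  exact ⟨C, M, hM.mono fun x => hC x.length⟩

/-! ### The polynomial padding and its total inverse -/

section Padding

open Polynomial Brick Plumb Turing
open scoped Notation

/-- **The polynomial pad** `polyPad k x = ⟨x, 1^{|x|^k}⟩` (pair code `boolPair`; Arora–Barak 2009,
§2.6.2: pad the input to length polynomial in `|x|`). [cite: AroraBarak2009, §2.6.2 (Thm. 2.22)] -/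
def polyPad (k : ℕ) (x : List Bool) : List Bool :=
  boolPair x (ones (x.length ^ k))

/-- Length of the pad: `2|x| + 2 + |x|^k`. [folklore] -/
@[simp] theorem length_polyPad (k : ℕ) (x : List Bool) :
    (polyPad k x).length = 2 * x.length + 2 + x.length ^ k := by
  simp [polyPad]

/-- The first component of a pad is the payload. [folklore] -/
@[simp] theorem fstF_polyPad (k : ℕ) (x : List Bool) : fstF (polyPad k x) = x := by
  simp [polyPad]

/-- `polyPad k` as a composite of bricks: `⟨id, 1^{Xᵏ(|·|)}⟩`. [folklore] -/
theorem polyPad_eq (k : ℕ) : polyPad k = fanoutFn id (polyFn (X ^ k)) := by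
  funext x
  simp [polyPad, fanoutFn_apply]

/-- `polyPad k ∈ FP`. [cite: AroraBarak2009, §2.6.2 (Thm. 2.22)] -/
theorem polyPad_mem_FP (k : ℕ) : polyPad k ∈ FP := by
  rw [polyPad_eq]
  exact fanoutFn_mem_FP OracleCompose.id_mem_FP (polyFn_mem_FP _)

/-- The validity test `z ↦ [z = polyPad k (fst z)]`. [folklore] -/
noncomputable def padValidFn (k : ℕ) : List Bool → List Bool :=
  eqPairFn ∘ fanoutFn id (polyPad k ∘ fstF)

/-- Value of the validity test. [folklore] -/
theorem padValidFn_apply (k : ℕ) (z : List Bool) :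
    padValidFn k z = [decide (z = polyPad k (fstF z))] := by
  simp [padValidFn, fanoutFn_apply, eqPairFn_boolPair]

/-- `padValidFn k ∈ FP`. [folklore] -/
theorem padValidFn_mem_FP (k : ℕ) : padValidFn k ∈ FP :=
  comp_mem_FP eqPairFn_mem_FP
    (fanoutFn_mem_FP OracleCompose.id_mem_FP (comp_mem_FP (polyPad_mem_FP k) fstF_mem_FP))

/-- **The total unpadding** `polyUnpad k`: a valid pad `⟨x, 1^{|x|^k}⟩` is sent to `x`, every
other word to `ε` (so that invalid words count as pads of the empty word). [folklore] -/
noncomputable def polyUnpad (k : ℕ) : List Bool → List Bool :=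
  iteFn (padValidFn k) fstF fun _ => []

/-- `polyUnpad k ∈ FP`. [folklore] -/
theorem polyUnpad_mem_FP (k : ℕ) : polyUnpad k ∈ FP :=
  iteFn_mem_FP (padValidFn_mem_FP k) fstF_mem_FP (const_mem_FP [])

/-- Unpadding a pad recovers the payload. [folklore] -/
@[simp] theorem polyUnpad_polyPad (k : ℕ) (x : List Bool) : polyUnpad k (polyPad k x) = x := by
  have h : padValidFn k (polyPad k x) = [true] := by
    rw [padValidFn_apply, fstF_polyPad]
    simp
  rw [polyUnpad, iteFn_apply_true h, fstF_polyPad]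

/-- The dichotomy of `polyUnpad`: either the word is the pad of its unpadding, or the unpadding
is empty. [folklore] -/
theorem polyUnpad_dichotomy (k : ℕ) (z : List Bool) :
    z = polyPad k (polyUnpad k z) ∨ polyUnpad k z = [] := by
  by_cases hz : z = polyPad k (fstF z)
  · have h : padValidFn k z = [true] := by rw [padValidFn_apply, decide_eq_true hz]
    left
    rw [polyUnpad, iteFn_apply_true h]
    exact hz
  · have h : padValidFn k z = [false] := by rw [padValidFn_apply]; simp [hz]
    right
    rw [polyUnpad, iteFn_apply_false h]

/-- The unpadding is short: `|polyUnpad k z|^k ≤ |z|`, unless it is empty. [folklore] -/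
theorem length_polyUnpad_pow_le (k : ℕ) (z : List Bool) :
    (polyUnpad k z).length ^ k ≤ z.length ∨ polyUnpad k z = [] := by
  rcases polyUnpad_dichotomy k z with h | h
  · left
    conv_rhs => rw [h]
    rw [length_polyPad]
    omega
  · exact Or.inr h

/-- The unpadding is not longer than the word. [folklore] -/
theorem length_polyUnpad_le (k : ℕ) (z : List Bool) : (polyUnpad k z).length ≤ z.length := by
  rcases polyUnpad_dichotomy k z with h | h
  · conv_rhs => rw [h]
    rw [length_polyPad]
    omega
  · simp [h]

/-- `2 ^ (|polyUnpad k z|^k) ≤ 2 · 2^{|z|}`. [folklore] -/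
theorem two_pow_length_polyUnpad_le (k : ℕ) (z : List Bool) :
    2 ^ ((polyUnpad k z).length ^ k) ≤ 2 * 2 ^ z.length := by
  rcases length_polyUnpad_pow_le k z with h | h
  · exact (Nat.pow_le_pow_right Nat.two_pos h).trans (Nat.le_mul_of_pos_left _ Nat.two_pos)
  · rw [h, List.length_nil]
    cases k with
    | zero => simpa using Nat.le_mul_of_pos_right 2 Nat.one_le_two_pow
    | succ k =>
      rw [Nat.zero_pow (Nat.succ_pos k), pow_zero]
      exact le_trans (by norm_num) (Nat.mul_le_mul_left 2 Nat.one_le_two_pow)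

/-- **The padded language** `padPre k L = polyUnpad k ⁻¹' L`: a word is in it iff its unpadding
is in `L` (so the pads `⟨x, 1^{|x|^k}⟩` of the words `x ∈ L`, together with all invalid words
when `ε ∈ L`; Arora–Barak 2009, §2.6.2: "`L_pad = {⟨x, 1^{2^{|x|^c}}⟩ : x ∈ L}`", here with a
polynomial pad). [cite: AroraBarak2009, §2.6.2 (Thm. 2.22)] -/
def padPre (k : ℕ) (L : Language Bool) : Language Bool :=
  {z | polyUnpad k z ∈ L}

/-- Membership in the padded language (definitional). [folklore] -/
@[simp] theorem mem_padPre {k : ℕ} {L : Language Bool} {z : List Bool} :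
    z ∈ padPre k L ↔ polyUnpad k z ∈ L :=
  Iff.rfl

/-- **`L` Karp-reduces to its padded version** along `polyPad k ∈ FP`.
[cite: AroraBarak2009, §2.6.2 (Thm. 2.22)] -/
theorem karpReducible_padPre (k : ℕ) (L : Language Bool) : L ≤ₚ padPre k L :=
  ⟨polyPad k, polyPad_mem_FP k, fun x => by
    show x ∈ L ↔ polyUnpad k (polyPad k x) ∈ L
    rw [polyUnpad_polyPad]⟩

/-! ### The padded language of an `NTIME(2^{nᵏ})` language is in `NTIME(2ⁿ)` -/

/-- **The clock machine behind the unpadding**: some machine maps every word `z` to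
`expClock c k (polyUnpad k z)` within `q(|z|) + C · 2^{|polyUnpad k z|^k}` steps (`q` a
polynomial): the `FP` machine of `polyUnpad k` followed by the clock program (`1 ≤ k`), resp. by
the `FP` machine of the constant clock `x ↦ ⟨x, 1^{3c}⟩` (`k = 0`). [folklore] -/
theorem exists_clock_machine (c k : ℕ) :
    ∃ (q : Polynomial ℕ) (C : ℕ) (N : TM2ComputableAux Bool Bool), ∀ z : List Bool,
      N.OutputsWithin z (expClock c k (polyUnpad k z))
        (q.eval z.length + C * 2 ^ ((polyUnpad k z).length ^ k)) := by
  obtain ⟨q₁, U, hU⟩ := polyUnpad_mem_FP k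
  rcases Nat.eq_zero_or_pos k with rfl | hk
  · -- constant clock, polynomial time
    have hF : (fanoutFn id fun _ : List Bool => ones (c * 2 + c)) ∈ FP :=
      fanoutFn_mem_FP OracleCompose.id_mem_FP (const_mem_FP _)
    have hcomp := comp_mem_FP hF ⟨q₁, U, hU⟩
    obtain ⟨q, N, hN⟩ := hcomp
    refine ⟨q, 0, N, fun z => ?_⟩
    have h := hN z
    have he : (fanoutFn id (fun _ : List Bool => ones (c * 2 + c)) ∘ polyUnpad 0) z =
        expClock c 0 (polyUnpad 0 z) := by
      simp [expClock, fanoutFn_apply, ones]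
    rw [he] at h
    simpa using h
  · obtain ⟨C, Ck, hCk⟩ := exists_timeComputable_expClock c hk
    refine ⟨q₁ + Polynomial.C C, C, U.comp Ck, fun z => ?_⟩
    have h := Turing.TM2ComputableAux.comp_outputsWithin U Ck (hU z) (hCk (polyUnpad k z))
    refine h.mono ?_
    simp only [id, eval_add, eval_C]
    omega

/-- **The padded language of an `NTIME(2^{nᵏ})` language is in `NTIME(2ⁿ)`** (the machine
content of "translating upward", Arora–Barak 2009, §2.6.2; Williams 2014, proof of Thm. 1.1,
p. 17). Given a verifier `(c, R, M)` of `L` in the tree's form of `NTIME(2^{nᵏ})`, the verifier of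
`padPre k L` on `⟨z, y⟩` is the truncating wrapper `truncMapAux` of `TruncMapMachine.lean` for
the clock `z ↦ expClock c k (polyUnpad k z)` — output `⟨x₀, y ↾ (c · 2^{n₀ᵏ} + c)⟩`,
`x₀ = polyUnpad k z`, `n₀ = |x₀|`, the discarded witness read two symbols per step — followed by
`M`; since `2^{n₀ᵏ} ≤ 2 · 2^{|z|}`, everything runs in time `O(2^{|z|}) + |y| / 2`, and the
relation `R x₀ (y ↾ (c · 2^{n₀ᵏ} + c))` has the same witnesses as `R x₀` inside the admissible
range. [cite: AroraBarak2009, §2.6.2 (Thm. 2.22)] -/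
theorem padPre_mem_NTIME_two_pow {L : Language Bool} {k : ℕ}
    (hL : L ∈ NTIME (fun n => 2 ^ (n ^ k))) : padPre k L ∈ NTIME (fun n => 2 ^ n) := by
  obtain ⟨c, R, M, hM, hLR⟩ := hL
  obtain ⟨q, C, Nc, hNc⟩ := exists_clock_machine c k
  obtain ⟨b, hb⟩ := TimeConstructible.exists_poly_le_two_pow_pow (q + 5 * X + 11) le_rfl
  -- the verifier
  let V : TM2ComputableAux Bool Bool := (truncMapAux Nc).comp M
  let B : List Bool → ℕ := fun z => c * 2 ^ ((polyUnpad k z).length ^ k) + c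
  let K : ℕ := b + 2 * (3 * c + C)
  refine ⟨2 * K + 2 * b + 2, fun z y => R (polyUnpad k z) (y.take (B z)), V,
    fun z y hy => ?_, fun z => ?_⟩
  · -- running time
    set x₀ := polyUnpad k z with hx₀
    set n₀ := x₀.length with hn₀
    have hclock := hNc z
    rw [← hx₀] at hclock
    have h₁ := outputsWithin_truncMapAux_boolPair Nc (y := y) hclock
    simp only [List.length_replicate, ← hn₀] at h₁
    have hy' : (y.take (c * 2 ^ (n₀ ^ k) + c)).length ≤ c * 2 ^ (n₀ ^ k) + c :=
      (List.length_take_le _ _)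
    have h₂ : M.OutputsWithin (boolPair x₀ (y.take (c * 2 ^ (n₀ ^ k) + c)))
        (encodeBool (R x₀ (y.take (c * 2 ^ (n₀ ^ k) + c)))) (c * 2 ^ (n₀ ^ k) + c) := by
      have := hM x₀ (y.take (c * 2 ^ (n₀ ^ k) + c)) hy'
      rwa [← hn₀] at this
    have h := Turing.TM2ComputableAux.comp_outputsWithin _ _ h₁ h₂
    have hBz : B z = c * 2 ^ (n₀ ^ k) + c := by simp [B, hn₀, hx₀]
    rw [show (fun z y => R (polyUnpad k z) (List.take (B z) y)) z y =
      R x₀ (y.take (c * 2 ^ (n₀ ^ k) + c)) by simp [hBz, hx₀]]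
    refine h.mono ?_
    -- the estimates
    have hpow : 2 ^ (n₀ ^ k) ≤ 2 * 2 ^ z.length := by
      rw [hn₀, hx₀]; exact two_pow_length_polyUnpad_le k z
    have hn₀z : n₀ ≤ z.length := by rw [hn₀, hx₀]; exact length_polyUnpad_le k z
    have hbz := hb z.length
    simp only [eval_add, eval_mul, eval_ofNat, eval_X, pow_one] at hbz
    have e1 : c * 2 ^ (n₀ ^ k) ≤ c * (2 * 2 ^ z.length) := Nat.mul_le_mul_left c hpow
    have e2 : C * 2 ^ (n₀ ^ k) ≤ C * (2 * 2 ^ z.length) := Nat.mul_le_mul_left C hpow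
    have hy2 : 2 * (y.length / 2) ≤ (2 * K + 2 * b + 2) * 2 ^ z.length + (2 * K + 2 * b + 2) :=
      (Nat.mul_div_le y.length 2).trans hy
    simp only [K] at hy2 ⊢
    nlinarith [e1, e2, hbz, hy2, hn₀z, Nat.one_le_two_pow (n := z.length)]
  · -- correctness
    rw [mem_padPre, hLR (polyUnpad k z)]
    set x₀ := polyUnpad k z with hx₀
    have hBz : B z = c * 2 ^ (x₀.length ^ k) + c := rfl
    constructor
    · rintro ⟨y₀, hy₀, hR⟩
      refine ⟨y₀, ?_, ?_⟩
      · have hpow : 2 ^ (x₀.length ^ k) ≤ 2 * 2 ^ z.length := two_pow_length_polyUnpad_le k z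
        have e1 : c * 2 ^ (x₀.length ^ k) ≤ c * (2 * 2 ^ z.length) := Nat.mul_le_mul_left c hpow
        simp only [K]
        nlinarith [e1, hy₀, Nat.one_le_two_pow (n := z.length)]
      · simp only [hBz]
        rwa [List.take_of_length_le hy₀]
    · rintro ⟨y, -, hR⟩
      exact ⟨y.take (B z), List.length_take_le _ _, hR⟩

/-- **Padding: `NTIME(2ⁿ) ⊆ P/poly → NEXP ⊆ P/poly`** (Arora–Barak 2009, §2.6.2, the translation
of Thm. 2.22; Williams 2014, proof of Thm. 1.1, p. 17: "if `NTIME[2ⁿ]` has polysize `ACC`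
circuits, then every language in `NEXP` has polysize `ACC` circuits"): for `L ∈ NTIME(2^{nᵏ})`
the padded language `padPre k L` is in `NTIME(2ⁿ) ⊆ P/poly` (`padPre_mem_NTIME_two_pow`), and
`L ≤ₚ padPre k L` (`karpReducible_padPre`), so `L ∈ P/poly` by the closure of `P/poly` under
Karp reductions (`mem_PPoly_of_karpReducible`). This is the statement of the named fact
`NEXP_subset_PPoly_of_NTIME_two_pow_subset` of `Williams2014Transfer.lean`.
[cite: AroraBarak2009, §2.6.2 (Thm. 2.22)] -/
theorem NEXP_subset_PPoly_of_NTIME_two_pow_subset_PPoly (h : NTIME (fun n => 2 ^ n) ⊆ PPoly) :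
    NEXP ⊆ PPoly := by
  intro L hL
  simp only [NEXP, Set.mem_iUnion] at hL
  obtain ⟨k, hk⟩ := hL
  exact mem_PPoly_of_karpReducible (karpReducible_padPre k L) (h (padPre_mem_NTIME_two_pow hk))

end Padding

end Literature.Computability.Complexity
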